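import Mathlib
import HarnessLib
import Summits.HubbardSuperconductivity.HubbardSuperconductivity.Theorems.KLProgrammeKLRegimeEngineScaleZeroDecay

/-!
# K3 engine child (stmt-HubbardSuperconductivity-19855), stub `stub_engine_scale0`, clause (E1-v4)₀: the lattice sizes of the engine
# regime (`L ≥ 2^15`, `β ≤ L`, `2 ≤ M`, `β ≤ M`, `β³ ≤ M`, `klE0·β ≤ π(2M-3)`) from the thresholds `klEngL₃`, `klEngM₃`

Cell gate-hubbard-kl, seat hubbard-kl-k3c2-p1.  The size hypotheses of `klAnisoLegKernelNorm_zero_le_order` that concern `L`, `M`, `β`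
follow from the engine thresholds `klEngL₃ β U ≤ L`, `klEngM₃ β U L ≤ M` (`KLProgrammeKLRegimeEngineV8Defs`) and `klBetaMin ≤ β`
(k3c4-p2's `pow_three_le_of_klEng`, `sq_le_of_klEngM₃_le`, `le_of_klEngL₃_le`).

* **`scaleZero_regime_sizes`**.

Everything is proved; no definitions, no named facts, no sorry.
-/

noncomputable section

namespace Summit.HubbardSuperconductivity.HubbardSuperconductivity.Theorems.EngineV8

set_option linter.dupNamespace false -- summit = problem name (single-conjunct summit), D-0017

open Real
open Summit.HubbardSuperconductivity.HubbardSuperconductivity.Theorems.KLRegimeSplit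
open Summit.HubbardSuperconductivity.HubbardSuperconductivity.Theorems.KLProgrammeLegKernels
open Summit.HubbardSuperconductivity.HubbardSuperconductivity.Theorems.ScaleZeroDecay

/-- **The lattice sizes of the engine regime**: `klBetaMin ≤ β`, `klEngL₃ β U ≤ L`, `klEngM₃ β U L ≤ M` give `2^15 ≤ L`, `β ≤ L`,
`2 ≤ M`, `β ≤ M`, `β³ ≤ M` and `klE0·β ≤ π(2M - 3)`. -/
theorem scaleZero_regime_sizes {β U : ℝ} {L M : ℕ} (hβ : klBetaMin ≤ β) (hL : klEngL₃ β U ≤ L) (hM : klEngM₃ β U L ≤ M) :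
    (2 : ℝ) ^ 15 ≤ L ∧ β ≤ L ∧ 2 ≤ M ∧ β ≤ (M : ℝ) ∧ β ^ 3 ≤ (M : ℝ) ∧ klE0 * β ≤ Real.pi * (2 * M - 3) := by
  have hβ128 : (128 : ℝ) ≤ β := by simpa [klBetaMin] using hβ
  have hβL : β ≤ L := le_of_klEngL₃_le hL
  have h3 : β ^ 3 ≤ (M : ℝ) := pow_three_le_of_klEng hβ hL hM
  have hβM : β ≤ (M : ℝ) := by
    have hβ1 : (1 : ℝ) ≤ β := by linarith
    have : β ≤ β ^ 3 := by
      calc β = β * 1 * 1 := by ring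
        _ ≤ β * β * β := by gcongr
        _ = β ^ 3 := by ring
    linarith
  have hπ3 : (3 : ℝ) < Real.pi := Real.pi_gt_three
  -- `2^15 ≤ L` from `klEngL₃ ≥ 2^10 (⌈β⌉+1)² ≥ 2^10·129²`
  have hL15 : (2 : ℝ) ^ 15 ≤ L := by
    unfold klEngL₃ at hL
    have hcast : ((2 ^ 10 * (⌈|β|⌉₊ + 1) ^ 2 * (⌈|U|⁻¹⌉₊ + 1) ^ 2 : ℕ) : ℝ) ≤ (L : ℝ) := by exact_mod_cast hL
    push_cast at hcast
    have hb : (129 : ℝ) ≤ (⌈|β|⌉₊ : ℝ) + 1 := by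
      have h1 : |β| ≤ (⌈|β|⌉₊ : ℝ) := Nat.le_ceil _
      have h2 : β ≤ |β| := le_abs_self β
      linarith
    have hb2 : (129 : ℝ) ^ 2 ≤ ((⌈|β|⌉₊ : ℝ) + 1) ^ 2 := pow_le_pow_left₀ (by norm_num) hb 2
    have hu : (1 : ℝ) ≤ ((⌈|U|⁻¹⌉₊ : ℝ) + 1) ^ 2 := by
      have : (0 : ℝ) ≤ (⌈|U|⁻¹⌉₊ : ℝ) := Nat.cast_nonneg _
      nlinarith
    nlinarith
  have hM2 : 2 ≤ M := by
    have : (2 : ℝ) ≤ M := by linarith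
    exact_mod_cast this
  refine ⟨hL15, hβL, hM2, hβM, h3, ?_⟩
  rw [show klE0 = 1 / 32 by norm_num [klE0]]
  nlinarith

end Summit.HubbardSuperconductivity.HubbardSuperconductivity.Theorems.EngineV8

end
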